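import Mathlib
import HarnessLib
import Summits.HubbardSuperconductivity.HubbardSuperconductivity.Theorems.KLProgrammeKLRegimeEngineTowerBlockIncrWtKlEngAll
import Summits.HubbardSuperconductivity.HubbardSuperconductivity.Theorems.KLProgrammeKLRegimeEngineTowerDoorToKit
import Summits.HubbardSuperconductivity.HubbardSuperconductivity.Theorems.KLProgrammeKLRegimeEngineTowerDoorToKitFO

/-!
# Route `KLProgramme` — crux K3 ENGINE (stmt-HubbardSuperconductivity-20437 `KLRegimeEngineV17F2`), stub (b) v2, THE LEVELS PACKAGE (ℓ):
# instantiation (I1), THE COMPOSED «MODEL Hstep IN KIT FORM» — the born weighted pinned sums of a block increment bounded by the KIT's step right side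
# (E1-LEVELS-BLUEPRINT-g8 §3 (I1)/§8/§9, E1 g8 HANDOFF «(I1) remaining: compose BlockIncrWt(Rate) + DoorToKit(+FO) + KitUnits into ONE model Hstep in kit form»;
#  cell gate-hubbard-kl, seat hubbard-kl-k3c3-p2 g13 as SUBSTITUTE typer while the E1 lineage is unseated — E1 may rename / supersede; located «(I1)-HSTEP-KIT-FORM»)

E1's `klWtPinnedSumAt_klTowerIncr_le` (…TowerBlockIncrWtRate, p578846) bounds the born weighted pinned sum of the block increment
`Δ_k = klTowerIncr … d k` at family `F_{J′}`, rate `j`, degree `2(q+1)`, by `ε^{2q+1}·(cr·cc^{2q+1}·[DOOR graded bracket] + cr·cc^{2q+1}·[DOOR binomial sum])`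
in the plateau doors' own index algebra (`ε = imagTimeWeight β M`, input sizes `B`).  The kit's induction `towerBorn_le_law_split` (part 9) wants its `hstep`
right side `towerFO D σ μ p + Σ_{n∈Icc 2 N} e·Φ^{n−1}·ψ^p·towerS D τ μ n p + ψ^p·e·towerV D τ μ·(Φ·towerV D τ μ)^N/(1 − Φ·towerV D τ μ)`.  E1's dictionary
bricks `doorGraded_le_kitStep` (p579248: `N := N₀ − 1`, `ψ := ρ⁻²`, `Φ := eα/κ²`, `τ := (e²(κ+ρ))²`) and `doorBinomial_le_towerFO` (p579342: `σ := κ²`) dominate the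
two door brackets by the kit's terms.  This file is the COMPOSITION, in ABSOLUTE sizes `N m := ε^{2m}·B m` (`B 0 = 0`), with the guard in KIT form
(`Φ·towerV D τ N < 1`, which implies the doors' `θ < 1` by `normV_le_towerV`) and the tail in the KIT's association:

* §1 `towerNumerics_doorBrackets_le_kit` — pure real algebra: the two door brackets `≤` the kit's three terms (`p = q + 1`);
* §2 **`klWtPinnedSumAt_klTowerIncr_le_kit`** — p578846 composed: every binder of p578846 except that the door guard `hθ` is replaced by the kit guard,
  plus `B 0 = 0` and a degree cap `D ≥ |Γ|/2`;
* §3 **`klWtPinnedSumAt_klTowerIncr_le_klEng_all_kit`** — the same for the window-free flow-frame form `klWtPinnedSumAt_klTowerIncr_le_klEng_all`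
  (…TowerBlockIncrWtKlEngAll, p633669: `κ, α, cr, cc` the tree's constants by equational binders, every block `k ≥ 1`, no depth window).
The division by the output unit (`kitStep_units`, …TowerKitUnits p579554: `τ̂ = τu`, `σ̂ = σu`, `Φ̂ = ΦK`, `ψ̂ = ψ/u`) is one rewrite on the right side and is
left to the owner of the carriers' unit convention ((I1-dim)).  Compositions of landed theorems; nothing about the model is asserted beyond them;
nothing asserts any stub, (ℓ), K3 or superconductivity.
References: BGM 2006 §2.7 (2.71a), §2.8 (2.77), (2.81)–(2.83), §3 (3.2)–(3.8) [cite: BenfattoGiulianiMastropietro2006].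
-/

noncomputable section

namespace Summit.HubbardSuperconductivity.HubbardSuperconductivity.Theorems.EngineV8

set_option linter.dupNamespace false -- summit = problem name (single-conjunct summit), D-0017

open Real Finset Literature.MathematicalPhysics.QuantumLattice Literature.Probability.LatticeModels GrassmannAlgebra
open Literature.MathematicalPhysics.QuantumLattice.BandSectorCounting
open Summit.HubbardSuperconductivity.HubbardSuperconductivity.Theorems.KLProgrammeLegKernels
open Summit.HubbardSuperconductivity.HubbardSuperconductivity.Theorems.KLRegimeSplit
open Summit.HubbardSuperconductivity.HubbardSuperconductivity.Theorems.KLRegimeWick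
open Summit.HubbardSuperconductivity.HubbardSuperconductivity.Theorems.TwoPointAssembly
open Summit.HubbardSuperconductivity.HubbardSuperconductivity.Theorems.TorusFourierL2
open Summit.HubbardSuperconductivity.HubbardSuperconductivity.Theorems.DispersionFlow
open Literature.Probability.LatticeModels.BattleFederbush

/-! ## §1 The two door brackets are dominated by the kit's three terms (pure real algebra) -/

/-- **Door brackets `≤` kit terms.**  For `κ, ρ > 0`, `α, cr, cc ≥ 0`, sizes `N ≥ 0` with `N 0 = 0`, a degree cap `D ≥ |Γ|/2`, `N₀ ≥ 2` and the KIT guard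
`(eα/κ²)·towerV D (e²(κ+ρ))² N < 1`:
`cr·cc^{2q+1}·[graded bracket] + cr·cc^{2q+1}·[binomial sum] ≤ cr·cc^{2q+1}·(towerFO D κ² N (q+1) + Σ_{n∈Icc 2 (N₀−1)} e·Φ^{n−1}·ψ^{q+1}·towerS D τ N n (q+1) + tail)`
in the kit's association (`τ = (e²(κ+ρ))²`, `Φ = eα/κ²`, `ψ = ρ⁻²`). -/
theorem towerNumerics_doorBrackets_le_kit {Γ : Type*} [Fintype Γ] {κ ρ α cr cc : ℝ} (hκ : 0 < κ) (hρ : 0 < ρ) (hα : 0 ≤ α)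
    (hcr : 0 ≤ cr) (hcc : 0 ≤ cc) {N : ℕ → ℝ} (hN0 : ∀ m, 0 ≤ N m) (hN00 : N 0 = 0) {D : ℕ} (hD : Fintype.card Γ / 2 ≤ D)
    {N₀ : ℕ} (hN₀ : 2 ≤ N₀) (q : ℕ)
    (hguard : exp 1 * α / κ ^ 2 * towerV D ((exp 2 * (κ + ρ)) ^ 2) N < 1) :
    cr * cc ^ (2 * q + 1) *
        ((∑ n ∈ Ico 2 N₀, (ρ⁻¹ ^ (2 * q + 1 + 1) * κ⁻¹ ^ (2 * (n - 1)) * (α ^ (n - 1) * exp n)) *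
            ∑ δ ∈ (Fintype.piFinset fun _ : Fin n => range (Fintype.card Γ / 2 + 1)) with 2 * q + 1 + 1 + 2 * (n - 1) ≤ ∑ a, 2 * δ a,
              ∏ a, (exp 2 * (κ + ρ)) ^ (2 * δ a) * N (δ a)) +
          ρ⁻¹ ^ (2 * q + 1 + 1) * (exp 1 * normV Γ κ ρ N) * (exp 1 * α * normV Γ κ ρ N / κ ^ 2) ^ (N₀ - 1) /
            (1 - exp 1 * α * normV Γ κ ρ N / κ ^ 2)) +
      cr * cc ^ (2 * q + 1) *
        ∑ m' ∈ range (Fintype.card Γ / 2 + 1),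
          (if q + 1 < m' then ((2 * m').choose (2 * (q + 1)) : ℝ) * κ ^ (2 * m' - 2 * (q + 1)) * N m' else 0) ≤
    cr * cc ^ (2 * q + 1) *
      (towerFO D (κ ^ 2) N (q + 1) +
        ∑ n ∈ Icc 2 (N₀ - 1), exp 1 * (exp 1 * α / κ ^ 2) ^ (n - 1) * (ρ⁻¹ ^ 2) ^ (q + 1) *
          towerS D ((exp 2 * (κ + ρ)) ^ 2) N n (q + 1) +
        (ρ⁻¹ ^ 2) ^ (q + 1) * exp 1 * towerV D ((exp 2 * (κ + ρ)) ^ 2) N *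
          (exp 1 * α / κ ^ 2 * towerV D ((exp 2 * (κ + ρ)) ^ 2) N) ^ (N₀ - 1) /
          (1 - exp 1 * α / κ ^ 2 * towerV D ((exp 2 * (κ + ρ)) ^ 2) N)) := by
  have hgr := doorGraded_le_kitStep (Γ := Γ) hκ hρ hα hN0 hN00 hD hN₀ (m := 2 * q + 1) (p := q + 1) (by ring) hguard
  have hfo := doorBinomial_le_towerFO hκ.le hN0 hD q
  have htail : (ρ⁻¹ ^ 2) ^ (q + 1) * (exp 1 * towerV D ((exp 2 * (κ + ρ)) ^ 2) N *
        (exp 1 * α / κ ^ 2 * towerV D ((exp 2 * (κ + ρ)) ^ 2) N) ^ (N₀ - 1) /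
        (1 - exp 1 * α / κ ^ 2 * towerV D ((exp 2 * (κ + ρ)) ^ 2) N)) =
      (ρ⁻¹ ^ 2) ^ (q + 1) * exp 1 * towerV D ((exp 2 * (κ + ρ)) ^ 2) N *
          (exp 1 * α / κ ^ 2 * towerV D ((exp 2 * (κ + ρ)) ^ 2) N) ^ (N₀ - 1) /
          (1 - exp 1 * α / κ ^ 2 * towerV D ((exp 2 * (κ + ρ)) ^ 2) N) := by
    ring
  rw [← mul_add]
  refine mul_le_mul_of_nonneg_left ?_ (by positivity)
  rw [htail] at hgr
  linarith

/-! ## §2 The composed model Hstep in kit form — binder version (E1's `klWtPinnedSumAt_klTowerIncr_le`) -/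

variable {L M : ℕ} [NeZero L]

section Born

variable [NeZero M]

/-- **THE MODEL Hstep IN KIT FORM (weighted track, absolute sizes).**  E1's `klWtPinnedSumAt_klTowerIncr_le` (p578846) with its door guard replaced
by the KIT guard `(eα/κ²)·towerV D (e²(κ+ρ))² N < 1` (`N m := ε^{2m}·B m`, `B 0 = 0`, `D ≥ |Γ|/2`), composed with E1's dictionary bricks: at every pin,
`klWtPinnedSumAt … J′ j (2(q+1)) Δ_k i w″ ≤ ε^{2q+1}·cr·cc^{2q+1}·(towerFO D κ² N (q+1) + Σ_{n∈Icc 2 (N₀−1)} e·Φ^{n−1}·ψ^{q+1}·towerS D τ N n (q+1) +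
ψ^{q+1}·e·towerV D τ N·(Φ·towerV D τ N)^{N₀−1}/(1 − Φ·towerV D τ N))` with `τ = (e²(κ+ρ))²`, `Φ = eα/κ²`, `ψ = ρ⁻²` — the `hstep` right side of
`towerBorn_le_law_split` before the division by the output unit (`kitStep_units`). -/
theorem klWtPinnedSumAt_klTowerIncr_le_kit {β : ℝ} (hβ : 0 < β) (U μ : ℝ) (K : TrigPolyC4v) {d k J' : ℕ} (j : ℕ) (hd : 1 ≤ d) (hk : 1 ≤ k)
    (hJ' : d * k ≤ J')
    (hZ : hubbardEffPartitionFnCT L M β U μ 0 K (klScale klE0 (d * k)) ≠ 0)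
    {κ : ℝ} (hκ : 0 < κ)
    (hGB : IsGramBoundedR ((sectorSubMatrix L M β (bgmFatMultiplier L M klE0 β (nambuXiCT L μ K) (d * k - 1))).transpose *
      hubbardCovSliceCT L M β μ 0 K (klScale klE0 (d * (k + 1))) (klScale klE0 (d * k)) *
        sectorSubMatrix L M β (bgmFatMultiplier L M klE0 β (nambuXiCT L μ K) (d * k - 1))) κ)
    (B : ℕ → ℝ) (hB0 : ∀ m', 0 ≤ B m') (hB00 : B 0 = 0)
    (hB : ∀ (m' : ℕ) (t : Fin (2 * m')) (w : SpaceTimeIdx L M × SectorLeg (sectorCount (d * k - 1))),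
      ∑ Y ∈ univ.filter (fun Y : Fin (2 * m') → SpaceTimeIdx L M × SectorLeg (sectorCount (d * k - 1)) => Y t = w),
        klScaleWt L M β j ((univ.image Y).image (latticeLegPos (2 * (2 * M)))) *
          ‖kernel ℂ (ExteriorAlgebra.map (Matrix.toLin' (sectorAnalysisMatrix L M β (klAnisoFamily L M β μ K klE0 (d * k - 1))))
            (klTowerInput L M β U μ K d k)) (2 * m') Y‖ ≤ B m')
    {α : ℝ} (hα : 0 < α)
    (hrow : ∀ X, ∑ Y, ‖((sectorSubMatrix L M β (bgmFatMultiplier L M klE0 β (nambuXiCT L μ K) (d * k - 1))).transpose *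
        hubbardCovSliceCT L M β μ 0 K (klScale klE0 (d * (k + 1))) (klScale klE0 (d * k)) *
          sectorSubMatrix L M β (bgmFatMultiplier L M klE0 β (nambuXiCT L μ K) (d * k - 1))) X Y‖ *
        klScaleWt L M β j {latticeLegPos (2 * (2 * M)) X, latticeLegPos (2 * (2 * M)) Y} ≤ α)
    (hcol : ∀ Y, ∑ X, ‖((sectorSubMatrix L M β (bgmFatMultiplier L M klE0 β (nambuXiCT L μ K) (d * k - 1))).transpose *
        hubbardCovSliceCT L M β μ 0 K (klScale klE0 (d * (k + 1))) (klScale klE0 (d * k)) *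
          sectorSubMatrix L M β (bgmFatMultiplier L M klE0 β (nambuXiCT L μ K) (d * k - 1))) X Y‖ *
        klScaleWt L M β j {latticeLegPos (2 * (2 * M)) X, latticeLegPos (2 * (2 * M)) Y} ≤ α)
    {ρ : ℝ} (hρ : 0 < ρ) {D : ℕ} (hD : Fintype.card (SpaceTimeIdx L M × SectorLeg (sectorCount (d * k - 1))) / 2 ≤ D)
    (hguard : Real.exp 1 * α / κ ^ 2 *
      towerV D ((Real.exp 2 * (κ + ρ)) ^ 2) (fun m' => imagTimeWeight β M ^ (2 * m') * B m') < 1)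
    {cr cc : ℝ} (hcr0 : 0 ≤ cr) (hcc0 : 0 ≤ cc)
    (hrow' : ∀ X'', ∑ X', ‖(sectorAnalysisMatrix L M β (klAnisoFamily L M β μ K klE0 J') *
        sectorSubMatrix L M β (bgmFatMultiplier L M klE0 β (nambuXiCT L μ K) (d * k - 1))) X'' X'‖ *
        klScaleWt L M β j {latticeLegPos (2 * (2 * M)) X'', latticeLegPos (2 * (2 * M)) X'} ≤ cr)
    (hcol' : ∀ X', ∑ X'', ‖(sectorAnalysisMatrix L M β (klAnisoFamily L M β μ K klE0 J') *
        sectorSubMatrix L M β (bgmFatMultiplier L M klE0 β (nambuXiCT L μ K) (d * k - 1))) X'' X'‖ *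
        klScaleWt L M β j {latticeLegPos (2 * (2 * M)) X'', latticeLegPos (2 * (2 * M)) X'} ≤ cc)
    {N₀ : ℕ} (hN₀ : 2 ≤ N₀) (q : ℕ) (i : Fin (2 * (q + 1))) (w'' : SpaceTimeIdx L M × SectorLeg (sectorCount J')) :
    klWtPinnedSumAt L M β μ K J' j (2 * (q + 1)) (klTowerIncr L M β U μ K d k) i w'' ≤
      imagTimeWeight β M ^ (2 * q + 1) *
        (cr * cc ^ (2 * q + 1) *
          (towerFO D (κ ^ 2) (fun m' => imagTimeWeight β M ^ (2 * m') * B m') (q + 1) +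
            ∑ n ∈ Icc 2 (N₀ - 1), Real.exp 1 * (Real.exp 1 * α / κ ^ 2) ^ (n - 1) * (ρ⁻¹ ^ 2) ^ (q + 1) *
              towerS D ((Real.exp 2 * (κ + ρ)) ^ 2) (fun m' => imagTimeWeight β M ^ (2 * m') * B m') n (q + 1) +
            (ρ⁻¹ ^ 2) ^ (q + 1) * Real.exp 1 * towerV D ((Real.exp 2 * (κ + ρ)) ^ 2) (fun m' => imagTimeWeight β M ^ (2 * m') * B m') *
              (Real.exp 1 * α / κ ^ 2 * towerV D ((Real.exp 2 * (κ + ρ)) ^ 2) (fun m' => imagTimeWeight β M ^ (2 * m') * B m')) ^ (N₀ - 1) /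
              (1 - Real.exp 1 * α / κ ^ 2 * towerV D ((Real.exp 2 * (κ + ρ)) ^ 2) (fun m' => imagTimeWeight β M ^ (2 * m') * B m')))) := by
  set N : ℕ → ℝ := fun m' => imagTimeWeight β M ^ (2 * m') * B m' with hN
  have hε : 0 ≤ imagTimeWeight β M := imagTimeWeight_nonneg hβ.le M
  have hN0 : ∀ m, 0 ≤ N m := fun m => mul_nonneg (pow_nonneg hε _) (hB0 m)
  have hN00 : N 0 = 0 := by simp [hN, hB00]
  -- the door guard from the kit guard
  have hnV := normV_le_towerV (Γ := SpaceTimeIdx L M × SectorLeg (sectorCount (d * k - 1))) hκ.le hρ.le hN0 hN00 hD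
  have hθ : Real.exp 1 * α * normV (SpaceTimeIdx L M × SectorLeg (sectorCount (d * k - 1))) κ ρ N / κ ^ 2 < 1 := by
    have heq : Real.exp 1 * α * normV (SpaceTimeIdx L M × SectorLeg (sectorCount (d * k - 1))) κ ρ N / κ ^ 2 =
        Real.exp 1 * α / κ ^ 2 * normV (SpaceTimeIdx L M × SectorLeg (sectorCount (d * k - 1))) κ ρ N := by ring
    rw [heq]
    exact lt_of_le_of_lt (mul_le_mul_of_nonneg_left hnV (by positivity)) hguard
  have hborn := klWtPinnedSumAt_klTowerIncr_le (L := L) (M := M) hβ U μ K j hd hk hJ' hZ hκ hGB B hB0 hB hα hrow hcol hρ hθ hcc0 hrow' hcol'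
    hN₀ q i w''
  refine hborn.trans (mul_le_mul_of_nonneg_left ?_ (pow_nonneg hε _))
  exact towerNumerics_doorBrackets_le_kit hκ hρ hα.le hcr0 hcc0 hN0 hN00 hD hN₀ q hguard

end Born

/-! ## §3 The composed model Hstep in kit form — window-free flow-frame version (`klWtPinnedSumAt_klTowerIncr_le_klEng_all`) -/

open Classical in
/-- **THE MODEL Hstep IN KIT FORM ON THE FLOW FRAME AT EVERY BLOCK, NO DEPTH WINDOW.**  `klWtPinnedSumAt_klTowerIncr_le_klEng_all` (p633669: `κ, α, cr, cc` the
tree's window-free constants by equational binders, (K5′) clauses, `U ≤ klEngU₀9`) with its door guard replaced by the KIT guard and composed with E1's dictionary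
bricks — same right side as `klWtPinnedSumAt_klTowerIncr_le_kit`. -/
theorem klWtPinnedSumAt_klTowerIncr_le_klEng_all_kit (d : ℕ) (R : RenConsts) (c'' : ℝ) (hc'' : 0 < c'') :
    ∃ Cκ Cb CJ CJ' : ℝ, 0 < Cκ ∧ 0 < Cb ∧ 0 < CJ ∧ 0 < CJ' ∧
      ∀ (G : GeoConsts) (P : SplitConsts) (Q : EngConsts) (c : ℝ), P.WF → R.WF2 → 0 < c → c ≤ klEngC₃6 P R →
      ∀ μ ∈ klWindowC, ∀ U : ℝ, 0 < U → U ≤ klEngU₀9 P R c → c'' * U ≤ 1 →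
      ∀ β : ℝ, klBetaMin ≤ β → β ≤ Real.exp (c / U ^ 2) →
      ∀ (L M : ℕ) [NeZero L] [NeZero M], klEngL₃ β U ≤ L → klEngM₃ β U L ≤ M →
      ∀ n : ℕ, 1 ≤ n → n ≤ nScales β + 1 → IsKLRegime U c (-(n : ℤ)) →
        HistP klPredsV17F2 L M G P Q R β U μ 0 n → FrameOK R U (nScales β) μ (klFlowFrameU L M β U μ n) →
        (∀ m, 1 ≤ m → m < n → FlowPieceOscAt L M c'' β U μ m) →
      ∀ k : ℕ, 1 ≤ d → 1 ≤ k → 2 ≤ d * k → d * (k + 1) ≤ nScales β + 1 → d * k ≤ n → ∀ j : ℕ, d * k ≤ j →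
      ∀ κ α cr cc : ℝ,
        κ = Real.sqrt (Cκ * (klScale klE0 (d * k) / klScale klE0 (d * k - 1)) * (klE0 * ((8 : ℝ) ^ (d * k - 1))⁻¹)) →
        α = Cb * ((M : ℝ) / β) / klScale klE0 (d * (k + 1)) →
        cr = 81 * CJ * M / β → cc = 81 * (2 : ℝ) ^ (d * k - (d * k - 1)) * CJ' * M / β →
      hubbardEffPartitionFnCT L M β U μ 0 (klFlowFrameU L M β U μ n) (klScale klE0 (d * k)) ≠ 0 →
      ∀ B : ℕ → ℝ, (∀ m', 0 ≤ B m') → B 0 = 0 →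
        (∀ (m' : ℕ) (t : Fin (2 * m')) (w : SpaceTimeIdx L M × SectorLeg (sectorCount (d * k - 1))),
          ∑ Y ∈ univ.filter (fun Y : Fin (2 * m') → SpaceTimeIdx L M × SectorLeg (sectorCount (d * k - 1)) => Y t = w),
            klScaleWt L M β j ((univ.image Y).image (latticeLegPos (2 * (2 * M)))) *
              ‖kernel ℂ (ExteriorAlgebra.map (Matrix.toLin' (sectorAnalysisMatrix L M β
                  (klAnisoFamily L M β μ (klFlowFrameU L M β U μ n) klE0 (d * k - 1))))
                (klTowerInput L M β U μ (klFlowFrameU L M β U μ n) d k)) (2 * m') Y‖ ≤ B m') →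
      ∀ ρ : ℝ, 0 < ρ → ∀ D : ℕ, Fintype.card (SpaceTimeIdx L M × SectorLeg (sectorCount (d * k - 1))) / 2 ≤ D →
        Real.exp 1 * α / κ ^ 2 * towerV D ((Real.exp 2 * (κ + ρ)) ^ 2) (fun m' => imagTimeWeight β M ^ (2 * m') * B m') < 1 →
      ∀ N₀ : ℕ, 2 ≤ N₀ → ∀ (q : ℕ) (i : Fin (2 * (q + 1))) (w'' : SpaceTimeIdx L M × SectorLeg (sectorCount (d * k))),
      klWtPinnedSumAt L M β μ (klFlowFrameU L M β U μ n) (d * k) j (2 * (q + 1))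
          (klTowerIncr L M β U μ (klFlowFrameU L M β U μ n) d k) i w'' ≤
        imagTimeWeight β M ^ (2 * q + 1) *
          (cr * cc ^ (2 * q + 1) *
            (towerFO D (κ ^ 2) (fun m' => imagTimeWeight β M ^ (2 * m') * B m') (q + 1) +
              ∑ n ∈ Icc 2 (N₀ - 1), Real.exp 1 * (Real.exp 1 * α / κ ^ 2) ^ (n - 1) * (ρ⁻¹ ^ 2) ^ (q + 1) *
                towerS D ((Real.exp 2 * (κ + ρ)) ^ 2) (fun m' => imagTimeWeight β M ^ (2 * m') * B m') n (q + 1) +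
              (ρ⁻¹ ^ 2) ^ (q + 1) * Real.exp 1 * towerV D ((Real.exp 2 * (κ + ρ)) ^ 2) (fun m' => imagTimeWeight β M ^ (2 * m') * B m') *
                (Real.exp 1 * α / κ ^ 2 * towerV D ((Real.exp 2 * (κ + ρ)) ^ 2) (fun m' => imagTimeWeight β M ^ (2 * m') * B m')) ^ (N₀ - 1) /
                (1 - Real.exp 1 * α / κ ^ 2 *
                  towerV D ((Real.exp 2 * (κ + ρ)) ^ 2) (fun m' => imagTimeWeight β M ^ (2 * m') * B m')))) := by
  obtain ⟨Cκ, Cb, CJ, CJ', hCκ, hCb, hCJ, hCJ', hall⟩ := klWtPinnedSumAt_klTowerIncr_le_klEng_all d R c'' hc''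
  refine ⟨Cκ, Cb, CJ, CJ', hCκ, hCb, hCJ, hCJ', ?_⟩
  intro G P Q c hP hR2 hc hc6 μ hμ U hU hU9 hcU β hβmin hβc L M _ _ hL3 hM3 n hn1 hnN hreg hhist hfr hosc k hd hk hdk hdk1 hkn j hj
    κ α cr cc hκ hα hcr hcc hZ B hB0 hB00 hB ρ hρ D hD hguard N₀ hN₀ q i w''
  have hβ : 0 < β := KLRegimeSplit.pos_of_klBetaMin_le hβmin
  have hM0 : (0 : ℝ) < M := Nat.cast_pos.2 (Nat.pos_of_ne_zero (NeZero.ne M))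
  have he : (0 : ℝ) < klE0 := by norm_num [klE0]
  set N : ℕ → ℝ := fun m' => imagTimeWeight β M ^ (2 * m') * B m' with hN
  have hε : 0 ≤ imagTimeWeight β M := imagTimeWeight_nonneg hβ.le M
  have hN0 : ∀ m, 0 ≤ N m := fun m => mul_nonneg (pow_nonneg hε _) (hB0 m)
  have hN00 : N 0 = 0 := by simp [hN, hB00]
  have hκpos : 0 < κ := by
    rw [hκ]
    have h1 : 0 < klScale klE0 (d * k) := klth_klScale_pos _
    have h2 : 0 < klScale klE0 (d * k - 1) := klth_klScale_pos _
    exact Real.sqrt_pos.2 (by positivity)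
  have hΛpos : 0 < klScale klE0 (d * (k + 1)) := klth_klScale_pos _
  have hαpos : 0 < α := by rw [hα]; positivity
  have hcr0 : 0 ≤ cr := by rw [hcr]; positivity
  have hcc0 : 0 ≤ cc := by rw [hcc]; positivity
  -- the door guard from the kit guard
  have hnV := normV_le_towerV (Γ := SpaceTimeIdx L M × SectorLeg (sectorCount (d * k - 1))) hκpos.le hρ.le hN0 hN00 hD
  have hθ : Real.exp 1 * α * normV (SpaceTimeIdx L M × SectorLeg (sectorCount (d * k - 1))) κ ρ N / κ ^ 2 < 1 := by
    have heq : Real.exp 1 * α * normV (SpaceTimeIdx L M × SectorLeg (sectorCount (d * k - 1))) κ ρ N / κ ^ 2 =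
        Real.exp 1 * α / κ ^ 2 * normV (SpaceTimeIdx L M × SectorLeg (sectorCount (d * k - 1))) κ ρ N := by ring
    rw [heq]
    exact lt_of_le_of_lt (mul_le_mul_of_nonneg_left hnV (by positivity)) hguard
  have hborn := hall G P Q c hP hR2 hc hc6 μ hμ U hU hU9 hcU β hβmin hβc L M hL3 hM3 n hn1 hnN hreg hhist hfr hosc k hd hk hdk hdk1 hkn j hj
    κ α cr cc hκ hα hcr hcc hZ B hB0 hB ρ hρ hθ N₀ hN₀ q i w''
  refine hborn.trans (mul_le_mul_of_nonneg_left ?_ (pow_nonneg hε _))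
  exact towerNumerics_doorBrackets_le_kit hκpos hρ hαpos.le hcr0 hcc0 hN0 hN00 hD hN₀ q hguard

end Summit.HubbardSuperconductivity.HubbardSuperconductivity.Theorems.EngineV8

end
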